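import Literature.AlgebraicGeometry.Resolution.BlowupStalkBlowupAlgebra
import HarnessLib

/-!
# Every prime of an affine blowup algebra `𝒪_{X,s}[J_s/c_j]` over `𝔪_s` is the local ring of a point of the blowing up

Topic: `Literature/AlgebraicGeometry/Resolution`. Converse half of the dictionary of `BlowupStalkBlowupAlgebra.lean`
(`IsBlowup.exists_blowupAlgebra_stalk_ringEquiv`: every point `x'` of a blowing up `π : X' → X` along `J` over `s` has
`𝒪_{X',x'} ≅ (𝒪_{X,s}[J_s/c_j])_𝔔` for SOME chart `j` and SOME prime `𝔔` over `𝔪_s`). Here: for EVERY chart index `j` and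
EVERY prime `𝔔` of the affine blowup algebra `𝒪_{X,s}[J_s/c_j]` (`blowupAlgebra`, Stacks 07Z3) lying over the maximal ideal
`𝔪_s`, there is a point `x' ∈ X'` with `π x' = s` and `𝒪_{X',x'} ≅ (𝒪_{X,s}[J_s/c_j])_𝔔`
(`IsBlowup.exists_point_of_blowupAlgebra_prime`). So ring-level conditions "at every prime of every chart algebra over
`𝔪_s`" and scheme-level conditions "at every point of every blowing up over `s`" are interchangeable.

Proof (Stacks 0804 + 0805, exactly the route of `IsBlowup.exists_chart_morphism` run from the chart side): the base change
`X' ×_X Spec 𝒪_{X,s} → Spec 𝒪_{X,s}` is a blowing up along `(J_s)~` (blowing up commutes with the flat base change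
`Spec 𝒪_{X,s} → X`, `IsBlowup.pullback_snd_of_flat`, `comap_fromSpecStalk_eq_affineBlowupIdealSheaf`), hence isomorphic over
`Spec 𝒪_{X,s}` to `Bl_{(c)} Spec 𝒪_{X,s} = Proj 𝒪_{X,s}[(c)t]` (`affineBlowup.isBlowup`, `IsBlowup.unique`); the prime `𝔔`
is a point `w` of the chart `Spec (𝒪_{X,s}[(c)t])_{(c_j t)}` (along `reesChartEquiv`, Stacks 07Z3), and
`x' :=` its image under chart ↪ `Proj` ≅ base change → `X'`; the first two maps are open immersions and the last induces
isomorphisms on local rings (`isIso_stalkMap_pullback_fst_fromSpecStalk`), so `𝒪_{X',x'} ≅ 𝒪_{Spec B_j, w} = (B_j)_w ≅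
(𝒪_{X,s}[J_s/c_j])_𝔔`; and `π x' = s` because `w` lies over the closed point of `Spec 𝒪_{X,s}`
(`Scheme.fromSpecStalk_closedPoint`). Everything is PROVED; no definitions, no named facts.

## Sources
* The Stacks Project, Tag 0804 (the blowing up of `Spec A` in `I` is covered by the spectra of the affine blowup algebras
  `A[I/a]`, `a ∈ I`), Tag 0805 (blowing up commutes with flat base change), Tag 07Z3 (`(A[It])_{(at)} ≅ A[I/a]`).
  [StacksProject]
* U. Görtz, T. Wedhorn, *Algebraic Geometry I*, 2nd ed. (2020), Prop. 13.91, (13.19). [GortzWedhorn2020]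
-/

noncomputable section

open CategoryTheory CategoryTheory.Limits AlgebraicGeometry TopologicalSpace IsLocalRing
  HomogeneousLocalization

namespace Literature.AlgebraicGeometry.Resolution

universe u

variable {X' X : Scheme.{u}} {π : X' ⟶ X} {J : X.IdealSheafData}

/-- Local rings at corresponding primes of isomorphic rings are isomorphic: for `e : A ≃+* B` and primes `Q ⊆ A`, `Q' ⊆ B`
with `e⁻¹(Q') = Q`, `A_Q ≅ B_{Q'}` (Mathlib `IsLocalization.ringEquivOfRingEquiv`). [folklore] -/
private theorem nonempty_ringEquiv_localization_of_ringEquiv {A B : Type*} [CommRing A] [CommRing B] (e : A ≃+* B)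
    (Q : Ideal A) (Q' : Ideal B) [Q.IsPrime] [Q'.IsPrime] (h : ∀ x : A, e x ∈ Q' ↔ x ∈ Q) :
    Nonempty (Localization.AtPrime Q ≃+* Localization.AtPrime Q') := by
  have hmap : Q.primeCompl.map e.toMonoidHom = Q'.primeCompl := by
    ext y
    simp only [Submonoid.mem_map, Ideal.mem_primeCompl_iff]
    constructor
    · rintro ⟨x, hx, rfl⟩
      exact fun hy => hx ((h x).mp hy)
    · intro hy
      refine ⟨e.symm y, fun hx => hy ?_, ?_⟩
      · have := (h (e.symm y)).mpr hx
        rwa [e.apply_symm_apply] at this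
      · change e (e.symm y) = y
        exact e.apply_symm_apply y
  exact ⟨IsLocalization.ringEquivOfRingEquiv (M := Q.primeCompl) (T := Q'.primeCompl)
    (Localization.AtPrime Q) (Localization.AtPrime Q') e hmap⟩

set_option maxHeartbeats 800000 in
-- the comparison with `Proj` over `Spec 𝒪_{X,s}` elaborates large terms (as in `IsBlowup.exists_chart_morphism`)
/-- **Every prime of `𝒪_{X,s}[J_s/c_j]` over `𝔪_s` is the local ring of a point of the blowing up over `s`.** Let
`π : X' → X` be a blowing up along `J` (`IsBlowup π J`), `s ∈ X`, and `c₁, …, c_k ∈ 𝒪_{X,s}` generators of the stalk `J_s`.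
For every index `j` and every prime `𝔔` of the affine blowup algebra `𝒪_{X,s}[J_s/c_j]` (`blowupAlgebra (c) c_j`) with
`𝔔 ∩ 𝒪_{X,s} = 𝔪_s` there is a point `x' ∈ X'` with `π x' = s` and a ring isomorphism `𝒪_{X',x'} ≅ (𝒪_{X,s}[J_s/c_j])_𝔔`.
Converse of `IsBlowup.exists_blowupAlgebra_stalk_ringEquiv`. [cite: StacksProject, Tag 0804; StacksProject, Tag 0805] -/
theorem IsBlowup.exists_point_of_blowupAlgebra_prime (hπ : IsBlowup π J) (s : X) {k : ℕ}
    (c : Fin k → X.presheaf.stalk s) (hc : Ideal.span (Set.range c) = stalkIdeal J s) (j : Fin k)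
    (𝔔 : PrimeSpectrum (blowupAlgebra (Ideal.span (Set.range c)) (c j)))
    (h𝔔 : 𝔔.asIdeal.comap (algebraMap _ (blowupAlgebra (Ideal.span (Set.range c)) (c j))) =
      maximalIdeal (X.presheaf.stalk s)) :
    ∃ x' : X', π x' = s ∧ Nonempty (X'.presheaf.stalk x' ≃+* Localization.AtPrime 𝔔.asIdeal) := by
  classical
  have hcj : ∀ j, c j ∈ Ideal.span (Set.range c) := fun j =>
    Ideal.mem_span_range_self (f := c) (x := j)
  haveI : Flat (X.fromSpecStalk s) := flat_fromSpecStalk X s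
  -- the base change `P = X' ×_X Spec 𝒪_{X,s} → Spec 𝒪_{X,s}` is a blowing up along `(J_s)~ = (c)~`
  have hP : IsBlowup (pullback.snd π (X.fromSpecStalk s))
      (affineBlowup.idealSheaf (Ideal.span (Set.range c))) := by
    have h := hπ.pullback_snd_of_flat (X.fromSpecStalk s)
    rwa [comap_fromSpecStalk_eq_affineBlowupIdealSheaf, ← hc] at h
  -- hence isomorphic to `Proj 𝒪_{X,s}[(c) t]` over `Spec 𝒪_{X,s}`
  obtain ⟨e, he, -⟩ := (affineBlowup.isBlowup (Ideal.span (Set.range c))).unique hP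
  -- the chart isomorphism `ε : B_j ≃ 𝒪_{X,s}[(c)/c_j]` and the point `w = ε⁻¹ 𝔔` of `Spec B_j`
  set ε : chartRing c j ≃+* blowupAlgebra (Ideal.span (Set.range c)) (c j) :=
    reesChartEquiv (I := Ideal.span (Set.range c)) (c j) (hcj j) with hεdef
  have hε : ∀ a, ε (chartBase c j a) = algebraMap _ (blowupAlgebra (Ideal.span (Set.range c)) (c j)) a :=
    reesChartEquiv_reesChartBase (c j) _
  let w : Spec (.of (chartRing c j)) := ⟨𝔔.asIdeal.comap (ε : chartRing c j →+* _), Ideal.comap_isPrime (ε : chartRing c j →+* _) 𝔔.asIdeal⟩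
  have hmemw : ∀ b : chartRing c j, ε b ∈ 𝔔.asIdeal ↔ b ∈ w.asIdeal := fun b => Iff.rfl
  -- `w` lies over the closed point of `Spec 𝒪_{X,s}`
  have hw : (Spec.map (CommRingCat.ofHom (chartBase c j))).base w = closedPoint (X.presheaf.stalk s) := by
    rw [Spec.map_base]
    change PrimeSpectrum.comap (chartBase c j) w = closedPoint (X.presheaf.stalk s)
    ext a
    change chartBase c j a ∈ w.asIdeal ↔ a ∈ (closedPoint (X.presheaf.stalk s)).asIdeal
    rw [← hmemw, hε, show (closedPoint (X.presheaf.stalk s)).asIdeal = maximalIdeal _ from rfl, ← h𝔔,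
      Ideal.mem_comap]
  -- the chart morphism `q : Spec B_j → Proj ≅ P → X'` and the point `x' = q w`
  let q : Spec (.of (chartRing c j)) ⟶ X' :=
    (affineBlowup.chartι (c j) (hcj j) ≫ e.hom) ≫ pullback.fst π (X.fromSpecStalk s)
  have hqπ : q ≫ π = Spec.map (CommRingCat.ofHom (chartBase c j)) ≫ X.fromSpecStalk s := by
    rw [Category.assoc, pullback.condition, Category.assoc, reassoc_of% he, ← Category.assoc,
      affineBlowup.chartι_π (c j) (hcj j)]
  refine ⟨q w, ?_, ?_⟩
  · -- `π (q w) = fromSpecStalk s (closed point) = s`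
    have h1 : π (q w) = (q ≫ π) w := (Scheme.Hom.comp_apply q π w).symm
    rw [h1, hqπ, Scheme.Hom.comp_apply, hw, Scheme.fromSpecStalk_closedPoint]
  · -- `𝒪_{X', q w} ≅ 𝒪_{Spec B_j, w} = (B_j)_w ≅ (𝒪_{X,s}[(c)/c_j])_𝔔`
    have h1 := isIso_stalkMap_pullback_fst_fromSpecStalk π s
      ((affineBlowup.chartι (c j) (hcj j) ≫ e.hom) w)
    haveI : IsOpenImmersion (affineBlowup.chartι (c j) (hcj j) ≫ e.hom) := inferInstance
    have h2 : IsIso ((affineBlowup.chartι (c j) (hcj j) ≫ e.hom).stalkMap w) := inferInstance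
    haveI : IsIso (q.stalkMap w) := by
      change IsIso (((affineBlowup.chartι (c j) (hcj j) ≫ e.hom) ≫ pullback.fst π (X.fromSpecStalk s)).stalkMap w)
      rw [Scheme.Hom.stalkMap_comp]
      exact @IsIso.comp_isIso _ _ _ _ _ _ _ h1 h2
    obtain ⟨e3⟩ := nonempty_ringEquiv_localization_of_ringEquiv ε w.asIdeal 𝔔.asIdeal hmemw
    exact ⟨((asIso (q.stalkMap w)).commRingCatIsoToRingEquiv.trans
      (Spec.stalkIso (.of (chartRing c j)) w).commRingCatIsoToRingEquiv).trans e3⟩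

end Literature.AlgebraicGeometry.Resolution

end
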